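import Mathlib
import Summits.PneNP.PneNP.Theses.RamseyUncertifiable
import Summits.PneNP.PneNP.Theorems.RamseyNotNP.Negative.ComplementSymmetry
import Literature.Computability.Complexity.NPClosureProofs

/-!
# Line `Sketch` of the crux `RamseyNotNP` (stmt-PneNP-9814): the capture lattice around the open stub D (TCC)

`X = Summit.PneNP.PneNP.Theses.RamseyUncertifiable.RamseyNotNP` (RAMSEY₂ ∉ NP).  The skeleton
`Cruxes/RamseyNotNP/Lines/Sketch.lean` closes `X` from three landed stubs and ONE open, conjecture-grade stub
D = `stub_typicalCliqueCapture` (TCC, "typical one-sided capture"): every `NP` language of graph codes all of whose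
members are `⌈2log₂n⌉`-clique-free misses a constant fraction of all graphs on `Fin n` infinitely often.

This helper file (co-lead c1, cycle 2 of the line) lands, importably and hypothesis-explicitly, the lattice of
capture hypotheses around D that the planners need in order to place it (the overlapping parts agree with the
co-lead's evidence certificate `Cruxes/RamseyNotNP/Lines/SketchDeadCertificate.lean` §4 and with triage-1's
evidence `MergeLemma.lean`; neither of those is an importable module):

* `symm_toLanguage_mem_NP`, `two_mul_card_le_card_symm_add` — the symmetrisation `S ↦ {G ∈ S | Gᶜ ∈ S}` keeps
  `NP`-ness (FP complement map on codes `Negative.exists_complFn`, `Negative.inter_mem_NP`, `preimage_mem_NP`) and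
  costs at most one more complement of `S` (`2·#S ≤ #sym + #all`);
* `twoSided_iff_oneSided` — **T₂ ↔ TCC**: the two-sided capture hypothesis (families of 2-RAMSEY codes) and the
  one-sided registered stub (families of CLIQUE-FREE codes) are equivalent — "one-sided" is free at density `→ 1`;
* `twoSided_of_denseBreaker`, `oneSided_of_denseBreaker` — **X_{1/2} → T₂ → TCC**: ideator 2's
  `DenseBreakerMeetsPlanted` (every `NP` language of eventual density `≥ 1/2` contains a non-Ramsey code) is the
  strongest of the three named hypotheses;
* `oneSided_at_ramsey_iff` — **point-of-use audit**: the composition `RamseyNotNP_of` invokes D at ONE family,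
  `S = RAMSEY₂`; given the density of RAMSEY₂ (hypothesis `hDense`, discharged by the landed
  `TypicalCapture.ramseyDense_filter`, p88147) that single instance is EQUIVALENT to `X` — so no reshaping of D
  inside the line is weaker than the crux (and `X ⟹ coNP ≠ NP`, `Negative.coNP_ne_NP_of_ramseyNotNP`);
* `ramseyNotNP_of_twoSided`, `coNP_ne_NP_of_twoSided` — T₂ closes the crux exactly as TCC does, hence is itself
  `≥ coNP ≠ NP`.

No new definitions; pure Mathlib / route / landed vocabulary.  The density of RAMSEY₂ enters only as the explicit
hypothesis `hDense` (verbatim the conclusion of `ramseyDense_filter`).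
Sources: Krajíček, *Forcing with random variables and proof complexity* (2011) §29.1 (density form of generator
hardness); Rudich 1997 (demi-bits, Def. 7); Erdős 1947.
-/

set_option linter.dupNamespace false

namespace Summit.PneNP.PneNP.Theorems.RamseyNotNP.CaptureLattice

open Finset
open Literature.Computability.Complexity _root_.Computability
open Summit.PneNP.PneNP.Theses.RamseyUncertifiable (RamseyNotNP)
open Summit.PneNP.PneNP.Theorems.RamseyNotNP.Negative (exists_complFn inter_mem_NP coNP_ne_NP_of_ramseyNotNP)

noncomputable section
open scoped Classical

/-! ### Symmetrisation keeps `NP` and costs one complement -/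

/-- The symmetrised family `{⟨n, G⟩ ∈ S | ⟨n, Gᶜ⟩ ∈ S}` of an `NP` family of graph codes is again `NP`:
its language is `L_S ⊓ f⁻¹ L_S` for the `FP` complement map `f` on codes (`Negative.exists_complFn`), and `NP`
is closed under `FP` preimages and binary intersections. [folklore] -/
theorem symm_toLanguage_mem_NP {S : Set (Σ n, SimpleGraph (Fin n))}
    (hS : encodingGraph.toLanguage S ∈ Nondeterministic.NP) :
    encodingGraph.toLanguage {p : Σ n, SimpleGraph (Fin n) | p ∈ S ∧ (⟨p.1, p.2ᶜ⟩ : Σ n, SimpleGraph (Fin n)) ∈ S}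
      ∈ Nondeterministic.NP := by
  obtain ⟨f, hf, hspec⟩ := exists_complFn
  have heq : encodingGraph.toLanguage
      {p : Σ n, SimpleGraph (Fin n) | p ∈ S ∧ (⟨p.1, p.2ᶜ⟩ : Σ n, SimpleGraph (Fin n)) ∈ S} =
      encodingGraph.toLanguage S ⊓ (f ⁻¹' encodingGraph.toLanguage S : Language Bool) := by
    refine Set.ext fun x => ⟨?_, ?_⟩
    · rintro ⟨⟨n, G⟩, ⟨hG, hGc⟩, rfl⟩
      refine ⟨(Encoding.mem_toLanguage_iff _ _ _).2 hG, ?_⟩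
      show f (encodingGraph.encode ⟨n, G⟩) ∈ encodingGraph.toLanguage S
      rw [hspec]
      exact (Encoding.mem_toLanguage_iff _ _ _).2 hGc
    · rintro ⟨hx, hfx⟩
      obtain ⟨⟨n, G⟩, hG, rfl⟩ := hx
      have hfx' : f (encodingGraph.encode ⟨n, G⟩) ∈ encodingGraph.toLanguage S := hfx
      rw [hspec] at hfx'
      exact ⟨⟨n, G⟩, ⟨hG, (Encoding.mem_toLanguage_iff _ _ _).1 hfx'⟩, rfl⟩
  rw [heq]
  exact inter_mem_NP hS (preimage_mem_NP hS hf)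

/-- Counting the symmetrisation: `2·#{G | G ∈ S} ≤ #{G | G ∈ S ∧ Gᶜ ∈ S} + #all` on `Fin n`
(inclusion–exclusion with the bijection `G ↦ Gᶜ` of `SimpleGraph (Fin n)`). [folklore] -/
theorem two_mul_card_le_card_symm_add (S : Set (Σ n, SimpleGraph (Fin n))) (n : ℕ) :
    2 * (univ.filter fun G : SimpleGraph (Fin n) => (⟨n, G⟩ : Σ m, SimpleGraph (Fin m)) ∈ S).card ≤
      (univ.filter fun G : SimpleGraph (Fin n) =>
          (⟨n, G⟩ : Σ m, SimpleGraph (Fin m)) ∈ S ∧ (⟨n, Gᶜ⟩ : Σ m, SimpleGraph (Fin m)) ∈ S).card +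
        Fintype.card (SimpleGraph (Fin n)) := by
  set A : Finset (SimpleGraph (Fin n)) :=
    univ.filter fun G : SimpleGraph (Fin n) => (⟨n, G⟩ : Σ m, SimpleGraph (Fin m)) ∈ S with hA
  set B : Finset (SimpleGraph (Fin n)) :=
    univ.filter fun G : SimpleGraph (Fin n) => (⟨n, Gᶜ⟩ : Σ m, SimpleGraph (Fin m)) ∈ S with hB
  have hAB : A.card = B.card := by
    refine card_bij' (fun G _ => Gᶜ) (fun G _ => Gᶜ) ?_ ?_ ?_ ?_
    · intro G hG
      simp only [hA, hB, mem_filter, mem_univ, true_and] at hG ⊢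
      simpa only [compl_compl] using hG
    · intro G hG
      simp only [hA, hB, mem_filter, mem_univ, true_and] at hG ⊢
      exact hG
    · intro G _
      simp
    · intro G _
      simp
  have hinter : A ∩ B = univ.filter fun G : SimpleGraph (Fin n) =>
      (⟨n, G⟩ : Σ m, SimpleGraph (Fin m)) ∈ S ∧ (⟨n, Gᶜ⟩ : Σ m, SimpleGraph (Fin m)) ∈ S := by
    ext G
    simp [hA, hB, mem_filter, mem_inter]
  have hunion : (A ∪ B).card ≤ Fintype.card (SimpleGraph (Fin n)) := by
    rw [← card_univ]
    exact card_le_card (subset_univ _)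
  have hie : (A ∪ B).card + (A ∩ B).card = A.card + B.card := card_union_add_card_inter A B
  rw [← hinter]
  omega

/-! ### Two-sided ⟺ one-sided capture (T₂ ↔ TCC) -/

/-- **T₂ ↔ TCC.** The two-sided typical-capture hypothesis — every `NP` family of 2-RAMSEY graph codes
(no clique and no independent set of size `⌈2log₂n⌉`) misses a constant fraction of all graphs on `Fin n`
infinitely often — is EQUIVALENT to the one-sided one (families of `⌈2log₂n⌉`-CLIQUE-FREE codes: verbatim the
registered stub `stub_typicalCliqueCapture` of line `Sketch`).  `←`: Ramsey families are clique-free families.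
`→`: symmetrise a clique-free family (`symm_toLanguage_mem_NP`): it becomes a Ramsey family, still `NP`, and if it
misses a `c`-fraction then the original misses a `c/2`-fraction (`two_mul_card_le_card_symm_add`). [folklore] -/
theorem twoSided_iff_oneSided :
    (∀ S : Set (Σ n, SimpleGraph (Fin n)),
      encodingGraph.toLanguage S ∈ Nondeterministic.NP →
      S ⊆ {p | p.2.CliqueFree (Nat.clog 2 (p.1 ^ 2)) ∧ p.2ᶜ.CliqueFree (Nat.clog 2 (p.1 ^ 2))} →
      ∃ c : ℝ, 0 < c ∧ ∀ n₀ : ℕ, ∃ n ≥ n₀,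
        ((univ.filter fun G : SimpleGraph (Fin n) => (⟨n, G⟩ : Σ m, SimpleGraph (Fin m)) ∈ S).card : ℝ) ≤
          (1 - c) * Fintype.card (SimpleGraph (Fin n))) ↔
    (∀ S : Set (Σ n, SimpleGraph (Fin n)),
      encodingGraph.toLanguage S ∈ Nondeterministic.NP →
      S ⊆ {p | p.2.CliqueFree (Nat.clog 2 (p.1 ^ 2))} →
      ∃ c : ℝ, 0 < c ∧ ∀ n₀ : ℕ, ∃ n ≥ n₀,
        ((univ.filter fun G : SimpleGraph (Fin n) => (⟨n, G⟩ : Σ m, SimpleGraph (Fin m)) ∈ S).card : ℝ) ≤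
          (1 - c) * Fintype.card (SimpleGraph (Fin n))) := by
  constructor
  · intro hT S hS hsub
    -- the symmetrised family
    set S' : Set (Σ n, SimpleGraph (Fin n)) :=
      {p : Σ n, SimpleGraph (Fin n) | p ∈ S ∧ (⟨p.1, p.2ᶜ⟩ : Σ n, SimpleGraph (Fin n)) ∈ S} with hS'def
    have hS'NP : encodingGraph.toLanguage S' ∈ Nondeterministic.NP := symm_toLanguage_mem_NP hS
    have hS'sub : S' ⊆ {p | p.2.CliqueFree (Nat.clog 2 (p.1 ^ 2)) ∧ p.2ᶜ.CliqueFree (Nat.clog 2 (p.1 ^ 2))} := by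
      rintro ⟨n, G⟩ ⟨hG, hGc⟩
      exact ⟨hsub hG, hsub hGc⟩
    obtain ⟨c, hc, hio⟩ := hT S' hS'NP hS'sub
    refine ⟨c / 2, by positivity, fun n₀ => ?_⟩
    obtain ⟨n, hn, hle⟩ := hio n₀
    refine ⟨n, hn, ?_⟩
    -- `2 #S ≤ #S' + T` and `#S' ≤ (1 - c) T` give `#S ≤ (1 - c/2) T`
    have hcount := two_mul_card_le_card_symm_add S n
    have hS'eq : (univ.filter fun G : SimpleGraph (Fin n) =>
          (⟨n, G⟩ : Σ m, SimpleGraph (Fin m)) ∈ S ∧ (⟨n, Gᶜ⟩ : Σ m, SimpleGraph (Fin m)) ∈ S) =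
        (univ.filter fun G : SimpleGraph (Fin n) => (⟨n, G⟩ : Σ m, SimpleGraph (Fin m)) ∈ S') := by
      ext G
      simp only [hS'def, mem_filter, mem_univ, true_and, Set.mem_setOf_eq]
    rw [hS'eq] at hcount
    have hcount' : (2 : ℝ) * ((univ.filter fun G : SimpleGraph (Fin n) =>
          (⟨n, G⟩ : Σ m, SimpleGraph (Fin m)) ∈ S).card : ℝ) ≤
        ((univ.filter fun G : SimpleGraph (Fin n) => (⟨n, G⟩ : Σ m, SimpleGraph (Fin m)) ∈ S').card : ℝ) +
          Fintype.card (SimpleGraph (Fin n)) := by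
      exact_mod_cast hcount
    have hle' : ((univ.filter fun G : SimpleGraph (Fin n) =>
          (⟨n, G⟩ : Σ m, SimpleGraph (Fin m)) ∈ S').card : ℝ) ≤
        (1 - c) * Fintype.card (SimpleGraph (Fin n)) := by
      convert hle using 4
    linarith
  · intro hT S hS hsub
    exact hT S hS fun p hp => (hsub hp).1

/-! ### The dense-breaker hypothesis X_{1/2} is the strongest: X_{1/2} → T₂ → TCC -/

/-- **X_{1/2} → T₂.** If every `NP` language of eventual density `≥ 1/2` among the graphs on `Fin n` contains
the code of a NON-Ramsey graph (ideator 2's `DenseBreakerMeetsPlanted`, inline as `hH`, the form used by the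
landed `TypicalCapture.ramseyNotNP_of_denseBreaker`), then every `NP` family of 2-Ramsey codes misses half of all
graphs infinitely often. [folklore] -/
theorem twoSided_of_denseBreaker
    (hH : ∀ L ∈ Nondeterministic.NP,
      (∃ n₀ : ℕ, ∀ n ≥ n₀, (Fintype.card (SimpleGraph (Fin n)) : ℝ) ≤
        2 * ((univ.filter fun G : SimpleGraph (Fin n) =>
          encodingGraph.encode (⟨n, G⟩ : Σ m, SimpleGraph (Fin m)) ∈ L).card : ℝ)) →
      ∃ p : Σ m, SimpleGraph (Fin m), encodingGraph.encode p ∈ L ∧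
        ¬ (p.2.CliqueFree (Nat.clog 2 (p.1 ^ 2)) ∧ p.2ᶜ.CliqueFree (Nat.clog 2 (p.1 ^ 2)))) :
    ∀ S : Set (Σ n, SimpleGraph (Fin n)),
      encodingGraph.toLanguage S ∈ Nondeterministic.NP →
      S ⊆ {p | p.2.CliqueFree (Nat.clog 2 (p.1 ^ 2)) ∧ p.2ᶜ.CliqueFree (Nat.clog 2 (p.1 ^ 2))} →
      ∃ c : ℝ, 0 < c ∧ ∀ n₀ : ℕ, ∃ n ≥ n₀,
        ((univ.filter fun G : SimpleGraph (Fin n) => (⟨n, G⟩ : Σ m, SimpleGraph (Fin m)) ∈ S).card : ℝ) ≤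
          (1 - c) * Fintype.card (SimpleGraph (Fin n)) := by
  intro S hS hsub
  refine ⟨1 / 2, one_half_pos, fun n₀ => ?_⟩
  by_contra hno
  push Not at hno
  -- then `S` has density `> 1/2` from `n₀` on, in the language form `hH` expects
  have hdens : ∃ n₀ : ℕ, ∀ n ≥ n₀, (Fintype.card (SimpleGraph (Fin n)) : ℝ) ≤
      2 * ((univ.filter fun G : SimpleGraph (Fin n) =>
        encodingGraph.encode (⟨n, G⟩ : Σ m, SimpleGraph (Fin m)) ∈ encodingGraph.toLanguage S).card : ℝ) := by
    refine ⟨n₀, fun n hn => ?_⟩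
    have h := hno n hn
    have heq : (univ.filter fun G : SimpleGraph (Fin n) =>
          encodingGraph.encode (⟨n, G⟩ : Σ m, SimpleGraph (Fin m)) ∈ encodingGraph.toLanguage S) =
        (univ.filter fun G : SimpleGraph (Fin n) => (⟨n, G⟩ : Σ m, SimpleGraph (Fin m)) ∈ S) := by
      ext G
      simp only [mem_filter, mem_univ, true_and, Encoding.mem_toLanguage_iff]
    rw [heq]
    linarith
  obtain ⟨p, hp, hpR⟩ := hH _ hS hdens
  exact hpR (hsub ((Encoding.mem_toLanguage_iff _ _ _).1 hp))

/-- **X_{1/2} → TCC** (triage-1's merge lemma, importable): the dense-breaker hypothesis implies the registered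
one-sided stub `stub_typicalCliqueCapture` of line `Sketch` (`twoSided_of_denseBreaker` and
`twoSided_iff_oneSided`). [folklore] -/
theorem oneSided_of_denseBreaker
    (hH : ∀ L ∈ Nondeterministic.NP,
      (∃ n₀ : ℕ, ∀ n ≥ n₀, (Fintype.card (SimpleGraph (Fin n)) : ℝ) ≤
        2 * ((univ.filter fun G : SimpleGraph (Fin n) =>
          encodingGraph.encode (⟨n, G⟩ : Σ m, SimpleGraph (Fin m)) ∈ L).card : ℝ)) →
      ∃ p : Σ m, SimpleGraph (Fin m), encodingGraph.encode p ∈ L ∧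
        ¬ (p.2.CliqueFree (Nat.clog 2 (p.1 ^ 2)) ∧ p.2ᶜ.CliqueFree (Nat.clog 2 (p.1 ^ 2)))) :
    ∀ S : Set (Σ n, SimpleGraph (Fin n)),
      encodingGraph.toLanguage S ∈ Nondeterministic.NP →
      S ⊆ {p | p.2.CliqueFree (Nat.clog 2 (p.1 ^ 2))} →
      ∃ c : ℝ, 0 < c ∧ ∀ n₀ : ℕ, ∃ n ≥ n₀,
        ((univ.filter fun G : SimpleGraph (Fin n) => (⟨n, G⟩ : Σ m, SimpleGraph (Fin m)) ∈ S).card : ℝ) ≤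
          (1 - c) * Fintype.card (SimpleGraph (Fin n)) :=
  twoSided_iff_oneSided.1 (twoSided_of_denseBreaker hH)

/-! ### Point-of-use audit: at `S = RAMSEY₂` the stub IS the crux -/

/-- **Point-of-use audit.** The skeleton's composition `RamseyNotNP_of` applies the stub D (TCC) to ONE family
only, `S = RAMSEY₂` itself.  That instance — "if RAMSEY₂ ∈ NP then it misses a constant fraction of all graphs
infinitely often" — is EQUIVALENT to the crux `X`, given that RAMSEY₂ has density `→ 1` (`hDense`, verbatim the
conclusion of the landed `TypicalCapture.ramseyDense_filter`, quantitative Erdős 1947): `→` by the density,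
`←` vacuously.  So no reshaping of D inside line `Sketch` is weaker than `X`. [folklore] -/
theorem oneSided_at_ramsey_iff
    (hDense : ∀ c : ℝ, 0 < c → ∃ n₀ : ℕ, ∀ n ≥ n₀, (1 - c) * (Fintype.card (SimpleGraph (Fin n)) : ℝ) <
      ((univ.filter fun G : SimpleGraph (Fin n) =>
        (⟨n, G⟩ : Σ m, SimpleGraph (Fin m)) ∈
          {p : Σ m, SimpleGraph (Fin m) | p.2.CliqueFree (Nat.clog 2 (p.1 ^ 2)) ∧
            p.2ᶜ.CliqueFree (Nat.clog 2 (p.1 ^ 2))}).card : ℝ)) :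
    (encodingGraph.toLanguage {p : Σ n, SimpleGraph (Fin n) |
        p.2.CliqueFree (Nat.clog 2 (p.1 ^ 2)) ∧ p.2ᶜ.CliqueFree (Nat.clog 2 (p.1 ^ 2))} ∈ Nondeterministic.NP →
      ∃ c : ℝ, 0 < c ∧ ∀ n₀ : ℕ, ∃ n ≥ n₀,
        ((univ.filter fun G : SimpleGraph (Fin n) => (⟨n, G⟩ : Σ m, SimpleGraph (Fin m)) ∈
            {p : Σ n, SimpleGraph (Fin n) |
              p.2.CliqueFree (Nat.clog 2 (p.1 ^ 2)) ∧ p.2ᶜ.CliqueFree (Nat.clog 2 (p.1 ^ 2))}).card : ℝ) ≤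
          (1 - c) * Fintype.card (SimpleGraph (Fin n))) ↔
    RamseyNotNP := by
  constructor
  · intro h hNP
    obtain ⟨c, hc, hio⟩ := h hNP
    obtain ⟨n₀, hn₀⟩ := hDense c hc
    obtain ⟨n, hn, hle⟩ := hio n₀
    have hle' : ((univ.filter fun G : SimpleGraph (Fin n) =>
        (⟨n, G⟩ : Σ m, SimpleGraph (Fin m)) ∈
          {p : Σ m, SimpleGraph (Fin m) | p.2.CliqueFree (Nat.clog 2 (p.1 ^ 2)) ∧
            p.2ᶜ.CliqueFree (Nat.clog 2 (p.1 ^ 2))}).card : ℝ) ≤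
      (1 - c) * Fintype.card (SimpleGraph (Fin n)) := by
      convert hle using 4
    exact absurd (hn₀ n hn) (not_lt.mpr hle')
  · intro hX hNP
    exact absurd hNP hX

/-- **T₂ → X** (given the density of RAMSEY₂): the two-sided stub closes the crux exactly as TCC does
(`TypicalCapture.ramseyNotNP_of_typicalCliqueCapture`). [folklore] -/
theorem ramseyNotNP_of_twoSided
    (hDense : ∀ c : ℝ, 0 < c → ∃ n₀ : ℕ, ∀ n ≥ n₀, (1 - c) * (Fintype.card (SimpleGraph (Fin n)) : ℝ) <
      ((univ.filter fun G : SimpleGraph (Fin n) =>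
        (⟨n, G⟩ : Σ m, SimpleGraph (Fin m)) ∈
          {p : Σ m, SimpleGraph (Fin m) | p.2.CliqueFree (Nat.clog 2 (p.1 ^ 2)) ∧
            p.2ᶜ.CliqueFree (Nat.clog 2 (p.1 ^ 2))}).card : ℝ))
    (hT : ∀ S : Set (Σ n, SimpleGraph (Fin n)),
      encodingGraph.toLanguage S ∈ Nondeterministic.NP →
      S ⊆ {p | p.2.CliqueFree (Nat.clog 2 (p.1 ^ 2)) ∧ p.2ᶜ.CliqueFree (Nat.clog 2 (p.1 ^ 2))} →
      ∃ c : ℝ, 0 < c ∧ ∀ n₀ : ℕ, ∃ n ≥ n₀,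
        ((univ.filter fun G : SimpleGraph (Fin n) => (⟨n, G⟩ : Σ m, SimpleGraph (Fin m)) ∈ S).card : ℝ) ≤
          (1 - c) * Fintype.card (SimpleGraph (Fin n))) :
    RamseyNotNP := by
  refine (oneSided_at_ramsey_iff hDense).1 fun hNP => ?_
  obtain ⟨c, hc, hio⟩ := hT _ hNP le_rfl
  refine ⟨c, hc, fun n₀ => ?_⟩
  obtain ⟨n, hn, hle⟩ := hio n₀
  -- (the two `Finset.filter`s may carry different `DecidablePred` instances; `convert` identifies them)
  exact ⟨n, hn, by convert hle using 4⟩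

/-- **T₂ ⟹ coNP ≠ NP** (given the density of RAMSEY₂; through the crux and the landed
`Negative.coNP_ne_NP_of_ramseyNotNP`): the two-sided stub, like D, is at least a separation of `coNP` from `NP`.
[folklore] -/
theorem coNP_ne_NP_of_twoSided
    (hDense : ∀ c : ℝ, 0 < c → ∃ n₀ : ℕ, ∀ n ≥ n₀, (1 - c) * (Fintype.card (SimpleGraph (Fin n)) : ℝ) <
      ((univ.filter fun G : SimpleGraph (Fin n) =>
        (⟨n, G⟩ : Σ m, SimpleGraph (Fin m)) ∈
          {p : Σ m, SimpleGraph (Fin m) | p.2.CliqueFree (Nat.clog 2 (p.1 ^ 2)) ∧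
            p.2ᶜ.CliqueFree (Nat.clog 2 (p.1 ^ 2))}).card : ℝ))
    (hT : ∀ S : Set (Σ n, SimpleGraph (Fin n)),
      encodingGraph.toLanguage S ∈ Nondeterministic.NP →
      S ⊆ {p | p.2.CliqueFree (Nat.clog 2 (p.1 ^ 2)) ∧ p.2ᶜ.CliqueFree (Nat.clog 2 (p.1 ^ 2))} →
      ∃ c : ℝ, 0 < c ∧ ∀ n₀ : ℕ, ∃ n ≥ n₀,
        ((univ.filter fun G : SimpleGraph (Fin n) => (⟨n, G⟩ : Σ m, SimpleGraph (Fin m)) ∈ S).card : ℝ) ≤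
          (1 - c) * Fintype.card (SimpleGraph (Fin n))) :
    coNP ≠ Nondeterministic.NP :=
  coNP_ne_NP_of_ramseyNotNP (ramseyNotNP_of_twoSided hDense hT)

end

end Summit.PneNP.PneNP.Theorems.RamseyNotNP.CaptureLattice
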